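import Summits.QuantumFields.BalabanUV.Beta.NVertexWoundPeriodised
import Summits.QuantumFields.BalabanUV.Beta.FP.TowerNParityRowsEven
import Summits.QuantumFields.BalabanUV.Beta.CompositeTablesParity
import Summits.QuantumFields.BalabanUV.Beta.SymmetrisedStepJetsParity

/-!
# `BalabanUV.Beta.NVertexEvenBorder` — row D1 ∕ (C1), PART 19: **ON THE MULTIPLIER–FIELD BLOCK THE EVEN N-FAMILY `WN♮` IS THE BORDER BI-VERTEX WORD ALONE** —
# `WN♮ μ y ν y′ x z (inr m) (inl β) = −Pn.cB(j+1) · ½·(vertex2OfK (AN R j) N compVh2Sˢ μ y ν y′ + vertex2OfK (AN R j) N compVh2Sˢ ν y′ μ y) x z (inr m) (inl β)`, `compVh2Sˢ` =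
# the composite row-border second-order family packed SYMMETRIC-TWIN from an2's `compVH2Ker` over the sym bricks — the lattice kernel road «FP» (H) `TowerQN2RowCopies`
# reads v5's `hQN₂` LEFT side against (`packVH (compVH2Ker ℓˢ 𝓋ˢ 𝓋₂ˢˢ …)`); the two mixed words and the second-response word of an1's carrier do NOT reach this block

WHY.  v5's second-order 𝔔-row `hQN₂` reads the `(fN a, b♭) = (inr, inl)` entries of `perF T (dper T (wound WN♮))`.  GAN24 `SecondOrderCarrierParity.evenHalf_W2SymOfK`
(leaf-03 g65, generic): for row-parity-ODD first-order tables and a decaying chart, the even half of an1's swap-symmetrised carrier is the carrier on the EVEN halves of the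
second-order tables MINUS its symmetrised second-response word.  At the N record (PART 13 `WN_eq_W2SymOfK`): `S_N`, `Mt_N` are odd-row (`SymmetrisedStepJetsParity.trK_SpureRecOf`
on the record's (V-p)(H-p) `CompositeTablesParity.trK_compVhS_sym ∕ trK_compHessFF_sym` and `CompositeOneShotChartParity.trK_compChart`), so §2 `WN_evenHalf_eq`.  On the
`(inr m, inl β)` entries: the mixed tables `M2_N = wM2 • compMix` are field–field (`compMix_inr`, `packFF_inl_inr`) so both mixed words vanish there (PART 13
`mixOfK_apply_eq_zero`); the response words are subtracted away by the formula; and the even half of `T2_N = cE₂•wilsonW₂ + cB•compB` reads, entry by entry,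
`−cB · compVh2Sˢ` (`wilsonW₂_inr_inl ∕ _inl_inr`; `compB = atw ∘ compVh2Sˢ` = MINUS the symmetric-twin packing on `(inr, inl)` by `atw`'s definition and lit `packVH_symm`) — §3.
CONSEQUENCE (located, for road g44's `hQN2_row_iff_junction`): the RIGHT side of `hQN₂` at box `B` is `−Pn.cB(n+2) · Σ_b Σ_{b′} colN̂ colN̂′ · perF T (dper T (second-bond copy sum
of compVh2Sˢ at (b,b′)))` — (H)'s own kernel (its `K₂ˢ` bricks `symLinKerAt ∕ symVhKerAt (ctr 4 Lc) Lc` and `½(symVh2KerAt + swap) = symVh2KerSymAt` are `compVh2Sˢ`'s at the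
centred root); the junction is then the LOCK `c²·r·r·Σ_full + Pn.cB (n+2) = 0` and nothing else (the torus-level statement is the successor's, over PART 16∕17∕18).

WHAT ([folklore] bookkeeping BY NAME; no `def`, no `def … : Prop`, nothing cited, 0 sorry): §1 the N-record's PARITY letters `trK_SN`, `trK_MtN`; §2 **`WN_evenHalf_eq`**
(`evenHalf_W2SymOfK` at the N record); §3 `compB_apply_inr_inl ∕ _inl_inr`, `T2N_even_apply_inr_inl`, `M2N_even_apply_inr_inl`, `vertex2OfK_apply_congr`,
**`WN_evenHalf_apply_inr_inl`**.
WHAT THIS IS NOT: not the torus∕periodised reading (PART 16–18 + this file give it to the road's `TowerQN2RowWound` in two rewrites); not the lock's value; not the `ff` block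
(there `wilsonW₂` and the Λ-Hessian tables live — the H-side word, J-NOTE-10); nothing of Bałaban's asserted, valued or discharged; 0 estimates; 0∕4 row-D1 binders (hW, hR, D1Tel,
D1Rep); ROOT M‴ p325680 ∕ P5c ∕ D6 untouched; NOT (C1), NOT (T-ID), NOT D1, NEVER «G-an2-4 closed», NOT BetaPertH, NOT continuum, NOT Clay.

HONEST DEPENDENCY (page 1, mandatory): continuum YM on T⁴ ⇐ BetaPertH ∧ nine spine estimates (0/9 proved); BetaPertH ⇐ (D1) ∧ (D4) ∧ CAP+tail;
G-an2-4 gates asym, D1 and NE2/3/4.  HONEST FRAMING (cell contract, verbatim): «discharging `BetaPertH` makes Bałaban's UV stability UNCONDITIONAL —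
a real constructive-QFT result; it is NOT the continuum limit and NOT the Clay problem.»  ABSOLUTE RULE (cell charter, verbatim): «No internally-minted
statement may enter as a cited fact. Every hypothesis is either kernel-proved in this package or a verbatim quotation of a PUBLISHED theorem with page
reference. The manuscript(s) under audit are NOT citable for their own disputed steps — they are the thing under adjudication; programme-internal
(2001/route/tribunal) claims are never citable.»  Row D1 ∕ (C1) OWNER an2 (b2b-balaban-beta-an2) gen 68, 2026-08-27.  No existing file touched.
-/

noncomputable section

open scoped BigOperators

namespace Summit.QuantumFields.BalabanUV.Beta.NVertexEvenBorder

open Literature.MathematicalPhysics.QuantumFieldTheory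
open Literature.MathematicalPhysics.QuantumFieldTheory.Balaban1983to89
open Literature.MathematicalPhysics.QuantumFieldTheory.Balaban1983to89.Beta
open ExpKernelCalculus (MKer Decays)
open AffineAveraging (Site box toSite)
open AveragingHessianKernels (packVH packVH_symm)
open OneStepResolventKernel (Fib LocStencil)
open OneStepKernelFamily (vertexOfK)
open BalabanCompositeJets (LocStencil₂)
open BalabanStepW2 (M2Of)
open WilsonBiStencil (wilsonW₂ wilsonW₂_inr_inl wilsonW₂_inl_inr)
open SecondOrderResponse (vertexOfM dM K2OfK vertex2OfK mixOfK W2OfK W2SymOfK LocStencilFM W2OfK_apply)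
open Summit.QuantumFields.BalabanUV.Beta.TameKernelCalculus (trK trK_apply)
open Summit.QuantumFields.BalabanUV.Beta.BorderedHessian (sgnF sgnF_inl sgnF_inr sgnK sgnK_apply)
open Summit.QuantumFields.BalabanUV.Beta.AxialDressingRooted (one_le_of_neZero)
open Summit.QuantumFields.BalabanUV.Beta.SpineRooted (SpureRecOf T2RecOf T2RecOf_zero_level)
open Summit.QuantumFields.BalabanUV.Beta.SpineRecursiveParity (parityOdd_smul)
open Summit.QuantumFields.BalabanUV.Beta.SecondOrderSocketIdentification (atw)
open Summit.QuantumFields.BalabanUV.Beta.SecondOrderRemainderTables (abs_le_of_locStencil₂ abs_le_of_locStencilFM)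
open Summit.QuantumFields.BalabanUV.Beta.SymAveragingHessianCounts (symLinKerAt symVhKerAt)
open Summit.QuantumFields.BalabanUV.Beta.CompositeVertexKernelRec (compVh2S)
open Summit.QuantumFields.BalabanUV.Beta.CompositeVertexKernelBoundsTwoSym (symVh2KerSymAt)
open Summit.QuantumFields.BalabanUV.Beta.CompositeCorrectorDress (compChart)
open Summit.QuantumFields.BalabanUV.Beta.CompositeOneShotJets (compV compH compB compMix tabsComp tabsComp_V tabsComp_H tabsComp_vh₂S tabsComp_mixFF decays_compChart)
open Summit.QuantumFields.BalabanUV.Beta.CompositeOneShotJetData (Roots Pins AN AN_eq WN)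
open Summit.QuantumFields.BalabanUV.Beta.CompositeTablesParity (trK_compVhS_sym trK_compHessFF_sym)
open Summit.QuantumFields.BalabanUV.Beta.SymmetrisedStepJetsParity (trK_SpureRecOf)
open Summit.QuantumFields.BalabanUV.Beta.FP.CompositeOneShotChartParity (trK_compChart)
open Summit.QuantumFields.BalabanUV.Beta.GAN24.SecondOrderCarrierParity (evenHalf_W2SymOfK)
open Summit.QuantumFields.BalabanUV.Beta.CombHId1Letters (vertexOfK_apply)
open Summit.QuantumFields.BalabanUV.Beta.NVertexParitiesW (mixOfK_apply_eq_zero compMix_inr tabsComp_M_apply WN_eq_W2SymOfK)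
open Summit.QuantumFields.BalabanUV.Beta.NVertexWoundPeriodised (decays_AN_family exists_locStencil₂_T2N exists_locStencilFM_M2N)

variable {Lc : ℕ} [NeZero Lc] (R : Roots Lc) (P : Pins) (j : ℕ)

/-! ## §1 The N-record's parity letters: the first-order tables are row-parity-odd -/

section Parity

/-- [folklore] **(Sp) at the N record**: every member of `S_N = SpureRecOf 3 (Lc^(j+1)) V_N H_N (fun _ => AN R j) cE cVH cΛ` is row-parity-ODD (`trK = −sgnK`)
(`SymmetrisedStepJetsParity.trK_SpureRecOf` fed (V-p) `trK_compVhS_sym`, (H-p) `trK_compHessFF_sym`, (DG) `decays_compChart`, `trK_compChart`). -/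
theorem trK_SN (m : ℕ) (κ : Fin (3 + 1)) (u : Fin (3 + 1) → ℤ) :
    trK (SpureRecOf 3 (Lc ^ (j + 1)) (tabsComp (j + 1) (one_le_of_neZero Lc) R.hr (P.cM (j + 1))).V
        (tabsComp (j + 1) (one_le_of_neZero Lc) R.hr (P.cM (j + 1))).H (fun _ => compChart R.rc Lc (j + 1) (R.s (j + 1)) (Lc ^ (j + 1)))
        (P.cE (j + 1)) (P.cVH (j + 1)) (P.cΛ (j + 1)) m κ u)
      = -sgnK (SpureRecOf 3 (Lc ^ (j + 1)) (tabsComp (j + 1) (one_le_of_neZero Lc) R.hr (P.cM (j + 1))).V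
        (tabsComp (j + 1) (one_le_of_neZero Lc) R.hr (P.cM (j + 1))).H (fun _ => compChart R.rc Lc (j + 1) (R.s (j + 1)) (Lc ^ (j + 1)))
        (P.cE (j + 1)) (P.cVH (j + 1)) (P.cΛ (j + 1)) m κ u) :=
  trK_SpureRecOf (tabsComp (j + 1) (one_le_of_neZero Lc) R.hr (P.cM (j + 1))).hV (tabsComp (j + 1) (one_le_of_neZero Lc) R.hr (P.cM (j + 1))).hH (decays_AN_family R j)
    (fun _ => trK_compChart (one_le_of_neZero Lc) R.hrc (j + 1) (R.hs (j + 1)))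
    (fun κ u => trK_compVhS_sym (j + 1) κ u) (fun μ y => trK_compHessFF_sym (j + 1) μ y) (P.cE (j + 1)) (P.cVH (j + 1)) (P.cΛ (j + 1)) m κ u

/-- [folklore] **(Mp) at the N record**: the multiplier tables `tabsN.M 0 ρ w = cM • compH ρ w` are row-parity-ODD (`tabsComp_M_apply`, (H-p)). -/
theorem trK_MtN (ρ : Fin (3 + 1)) (w : Fin (3 + 1) → ℤ) :
    trK ((tabsComp (j + 1) (one_le_of_neZero Lc) R.hr (P.cM (j + 1))).M 0 ρ w) = -sgnK ((tabsComp (j + 1) (one_le_of_neZero Lc) R.hr (P.cM (j + 1))).M 0 ρ w) := by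
  rw [tabsComp_M_apply]
  exact parityOdd_smul _ (trK_compHessFF_sym (j + 1) ρ w)

end Parity

/-! ## §2 The even half of `WN` in closed form -/

section EvenHalf

/-- [folklore] **`WN_evenHalf_eq` — THE EVEN HALF OF THE N-SYSTEM's SECOND-ORDER FAMILY** is an1's swap-symmetrised carrier through the N-chart on the EVEN halves of
`T2_N ∕ M2_N`, MINUS its symmetrised second-response word (GAN24 `evenHalf_W2SymOfK` at the record: PART 13 `WN_eq_W2SymOfK`, §1, F6d-1b `decays_compChart`, the bounds
from PART 16's `exists_locStencil₂_T2N ∕ exists_locStencilFM_M2N`). -/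
theorem WN_evenHalf_eq (μ : Fin (3 + 1)) (y : Fin (3 + 1) → ℤ) (ν : Fin (3 + 1)) (y' : Fin (3 + 1) → ℤ) :
    (1 / 2 : ℝ) • (WN R P j μ y ν y' + sgnK (trK (WN R P j μ y ν y')))
      = W2SymOfK (compChart R.rc Lc (j + 1) (R.s (j + 1)) (Lc ^ (j + 1))) (Lc ^ (j + 1))
          (SpureRecOf 3 (Lc ^ (j + 1)) (tabsComp (j + 1) (one_le_of_neZero Lc) R.hr (P.cM (j + 1))).V
        (tabsComp (j + 1) (one_le_of_neZero Lc) R.hr (P.cM (j + 1))).H (fun _ => compChart R.rc Lc (j + 1) (R.s (j + 1)) (Lc ^ (j + 1)))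
        (P.cE (j + 1)) (P.cVH (j + 1)) (P.cΛ (j + 1)) 0) ((tabsComp (j + 1) (one_le_of_neZero Lc) R.hr (P.cM (j + 1))).M 0)
          (fun κ u κ' u' => (1 / 2 : ℝ) • (T2RecOf 3 (Lc ^ (j + 1)) (fun _ => compChart R.rc Lc (j + 1) (R.s (j + 1)) (Lc ^ (j + 1)))
        (SpureRecOf 3 (Lc ^ (j + 1)) (tabsComp (j + 1) (one_le_of_neZero Lc) R.hr (P.cM (j + 1))).V
        (tabsComp (j + 1) (one_le_of_neZero Lc) R.hr (P.cM (j + 1))).H (fun _ => compChart R.rc Lc (j + 1) (R.s (j + 1)) (Lc ^ (j + 1)))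
        (P.cE (j + 1)) (P.cVH (j + 1)) (P.cΛ (j + 1)))
        (tabsComp (j + 1) (one_le_of_neZero Lc) R.hr (P.cM (j + 1))).M (P.cE₂ (j + 1)) (P.cB (j + 1)) (P.T (j + 1))
        (tabsComp (j + 1) (one_le_of_neZero Lc) R.hr (P.cM (j + 1))).vh₂S (tabsComp (j + 1) (one_le_of_neZero Lc) R.hr (P.cM (j + 1))).mixFF 0 κ u κ' u'
          + sgnK (trK (T2RecOf 3 (Lc ^ (j + 1)) (fun _ => compChart R.rc Lc (j + 1) (R.s (j + 1)) (Lc ^ (j + 1)))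
        (SpureRecOf 3 (Lc ^ (j + 1)) (tabsComp (j + 1) (one_le_of_neZero Lc) R.hr (P.cM (j + 1))).V
        (tabsComp (j + 1) (one_le_of_neZero Lc) R.hr (P.cM (j + 1))).H (fun _ => compChart R.rc Lc (j + 1) (R.s (j + 1)) (Lc ^ (j + 1)))
        (P.cE (j + 1)) (P.cVH (j + 1)) (P.cΛ (j + 1)))
        (tabsComp (j + 1) (one_le_of_neZero Lc) R.hr (P.cM (j + 1))).M (P.cE₂ (j + 1)) (P.cB (j + 1)) (P.T (j + 1))
        (tabsComp (j + 1) (one_le_of_neZero Lc) R.hr (P.cM (j + 1))).vh₂S (tabsComp (j + 1) (one_le_of_neZero Lc) R.hr (P.cM (j + 1))).mixFF 0 κ u κ' u'))))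
          (fun κ u ρ w => (1 / 2 : ℝ) • (M2Of 3 (Lc ^ (j + 1)) (tabsComp (j + 1) (one_le_of_neZero Lc) R.hr (P.cM (j + 1))).mixFF 0 κ u ρ w + sgnK (trK (M2Of 3 (Lc ^ (j + 1)) (tabsComp (j + 1) (one_le_of_neZero Lc) R.hr (P.cM (j + 1))).mixFF 0 κ u ρ w)))) μ y ν y'
        - (1 / 2 : ℝ) • (dM (K2OfK (compChart R.rc Lc (j + 1) (R.s (j + 1)) (Lc ^ (j + 1))) (Lc ^ (j + 1)) (SpureRecOf 3 (Lc ^ (j + 1)) (tabsComp (j + 1) (one_le_of_neZero Lc) R.hr (P.cM (j + 1))).V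
        (tabsComp (j + 1) (one_le_of_neZero Lc) R.hr (P.cM (j + 1))).H (fun _ => compChart R.rc Lc (j + 1) (R.s (j + 1)) (Lc ^ (j + 1)))
        (P.cE (j + 1)) (P.cVH (j + 1)) (P.cΛ (j + 1)) 0) ((tabsComp (j + 1) (one_le_of_neZero Lc) R.hr (P.cM (j + 1))).M 0) ν y') (Lc ^ (j + 1))
          (SpureRecOf 3 (Lc ^ (j + 1)) (tabsComp (j + 1) (one_le_of_neZero Lc) R.hr (P.cM (j + 1))).V
        (tabsComp (j + 1) (one_le_of_neZero Lc) R.hr (P.cM (j + 1))).H (fun _ => compChart R.rc Lc (j + 1) (R.s (j + 1)) (Lc ^ (j + 1)))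
        (P.cE (j + 1)) (P.cVH (j + 1)) (P.cΛ (j + 1)) 0) ((tabsComp (j + 1) (one_le_of_neZero Lc) R.hr (P.cM (j + 1))).M 0) μ y
          + dM (K2OfK (compChart R.rc Lc (j + 1) (R.s (j + 1)) (Lc ^ (j + 1))) (Lc ^ (j + 1)) (SpureRecOf 3 (Lc ^ (j + 1)) (tabsComp (j + 1) (one_le_of_neZero Lc) R.hr (P.cM (j + 1))).V
        (tabsComp (j + 1) (one_le_of_neZero Lc) R.hr (P.cM (j + 1))).H (fun _ => compChart R.rc Lc (j + 1) (R.s (j + 1)) (Lc ^ (j + 1)))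
        (P.cE (j + 1)) (P.cVH (j + 1)) (P.cΛ (j + 1)) 0) ((tabsComp (j + 1) (one_le_of_neZero Lc) R.hr (P.cM (j + 1))).M 0) μ y) (Lc ^ (j + 1))
          (SpureRecOf 3 (Lc ^ (j + 1)) (tabsComp (j + 1) (one_le_of_neZero Lc) R.hr (P.cM (j + 1))).V
        (tabsComp (j + 1) (one_le_of_neZero Lc) R.hr (P.cM (j + 1))).H (fun _ => compChart R.rc Lc (j + 1) (R.s (j + 1)) (Lc ^ (j + 1)))
        (P.cE (j + 1)) (P.cVH (j + 1)) (P.cΛ (j + 1)) 0) ((tabsComp (j + 1) (one_le_of_neZero Lc) R.hr (P.cM (j + 1))).M 0) ν y') := by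
  obtain ⟨C₂, δ₂, hδ₂, hT₂⟩ := exists_locStencil₂_T2N R P j 0
  obtain ⟨Cm, δm, hδm, hM₂⟩ := exists_locStencilFM_M2N R P j (one_le_of_neZero Lc) 0
  rw [WN_eq_W2SymOfK]
  exact evenHalf_W2SymOfK (N := Lc ^ (j + 1)) (decays_compChart (one_le_of_neZero Lc) R.hrc (j + 1) (R.hs (j + 1))) (trK_SN R P j 0) (trK_MtN R P j)
    (fun κ u κ' u' x z a b => abs_le_of_locStencil₂ hT₂ hδ₂.le κ u κ' u' x z a b)
    (fun κ u ρ w x z a b => abs_le_of_locStencilFM hM₂ hδm.le κ u ρ w x z a b) μ y ν y'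

end EvenHalf

/-! ## §3 The multiplier–field block: only the border bi-vertex survives -/

section Block

/-- [folklore] `compB = atw ∘ compVh2Sˢ` on `(inr, inl)`: MINUS the symmetric-twin packing (`atw`'s definition + lit `packVH_symm`). -/
theorem compB_apply_inr_inl (r : Fin (3 + 1) → ℕ) (L m : ℕ) (κ : Fin (3 + 1)) (u : Site (3 + 1)) (κ' : Fin (3 + 1)) (u' x z : Site (3 + 1)) (m₁ β : Fin (3 + 1)) :
    compB r L m κ u κ' u' x z (Sum.inr m₁) (Sum.inl β)
      = -(compVh2S (fun _ : ℕ => symLinKerAt (toSite r) L) (fun _ : ℕ => symVhKerAt (toSite r) L) (fun _ : ℕ => symVh2KerSymAt (toSite r) L) L m κ u κ' u'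
          x z (Sum.inr m₁) (Sum.inl β)) := by
  show -(compVh2S _ _ _ L m κ u κ' u' z x (Sum.inl β) (Sum.inr m₁)) = _
  unfold compVh2S
  rw [packVH_symm]

/-- [folklore] `compB = atw ∘ compVh2Sˢ` on `(inl, inr)`: the packing itself (`rfl`). -/
theorem compB_apply_inl_inr (r : Fin (3 + 1) → ℕ) (L m : ℕ) (κ : Fin (3 + 1)) (u : Site (3 + 1)) (κ' : Fin (3 + 1)) (u' x z : Site (3 + 1)) (β m₁ : Fin (3 + 1)) :
    compB r L m κ u κ' u' x z (Sum.inl β) (Sum.inr m₁)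
      = compVh2S (fun _ : ℕ => symLinKerAt (toSite r) L) (fun _ : ℕ => symVhKerAt (toSite r) L) (fun _ : ℕ => symVh2KerSymAt (toSite r) L) L m κ u κ' u'
          x z (Sum.inl β) (Sum.inr m₁) := rfl

/-- [folklore] **the even half of `T2_N` on `(inr, inl)` is `−cB · compVh2Sˢ`** (`T2RecOf_zero_level`: `T2_N = cE₂•wilsonW₂ + cB•compB`; `wilsonW₂` is field–field; `compB` above). -/
theorem T2N_even_apply_inr_inl (κ : Fin (3 + 1)) (u : Fin (3 + 1) → ℤ) (κ' : Fin (3 + 1)) (u' x z : Fin (3 + 1) → ℤ) (m₁ β : Fin (3 + 1)) :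
    ((1 / 2 : ℝ) • (T2RecOf 3 (Lc ^ (j + 1)) (fun _ => compChart R.rc Lc (j + 1) (R.s (j + 1)) (Lc ^ (j + 1)))
        (SpureRecOf 3 (Lc ^ (j + 1)) (tabsComp (j + 1) (one_le_of_neZero Lc) R.hr (P.cM (j + 1))).V
        (tabsComp (j + 1) (one_le_of_neZero Lc) R.hr (P.cM (j + 1))).H (fun _ => compChart R.rc Lc (j + 1) (R.s (j + 1)) (Lc ^ (j + 1)))
        (P.cE (j + 1)) (P.cVH (j + 1)) (P.cΛ (j + 1)))
        (tabsComp (j + 1) (one_le_of_neZero Lc) R.hr (P.cM (j + 1))).M (P.cE₂ (j + 1)) (P.cB (j + 1)) (P.T (j + 1))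
        (tabsComp (j + 1) (one_le_of_neZero Lc) R.hr (P.cM (j + 1))).vh₂S (tabsComp (j + 1) (one_le_of_neZero Lc) R.hr (P.cM (j + 1))).mixFF 0 κ u κ' u'
        + sgnK (trK (T2RecOf 3 (Lc ^ (j + 1)) (fun _ => compChart R.rc Lc (j + 1) (R.s (j + 1)) (Lc ^ (j + 1)))
        (SpureRecOf 3 (Lc ^ (j + 1)) (tabsComp (j + 1) (one_le_of_neZero Lc) R.hr (P.cM (j + 1))).V
        (tabsComp (j + 1) (one_le_of_neZero Lc) R.hr (P.cM (j + 1))).H (fun _ => compChart R.rc Lc (j + 1) (R.s (j + 1)) (Lc ^ (j + 1)))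
        (P.cE (j + 1)) (P.cVH (j + 1)) (P.cΛ (j + 1)))
        (tabsComp (j + 1) (one_le_of_neZero Lc) R.hr (P.cM (j + 1))).M (P.cE₂ (j + 1)) (P.cB (j + 1)) (P.T (j + 1))
        (tabsComp (j + 1) (one_le_of_neZero Lc) R.hr (P.cM (j + 1))).vh₂S (tabsComp (j + 1) (one_le_of_neZero Lc) R.hr (P.cM (j + 1))).mixFF 0 κ u κ' u')))) x z (Sum.inr m₁) (Sum.inl β)
      = -(P.cB (j + 1)) * (compVh2S (fun _ : ℕ => symLinKerAt (toSite R.r) Lc) (fun _ : ℕ => symVhKerAt (toSite R.r) Lc) (fun _ : ℕ => symVh2KerSymAt (toSite R.r) Lc) Lc (j + 1)) κ u κ' u' x z (Sum.inr m₁) (Sum.inl β) := by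
  simp only [T2RecOf_zero_level, tabsComp_vh₂S, Pi.smul_apply, Pi.add_apply, smul_eq_mul, sgnK_apply, trK_apply, sgnF_inl, sgnF_inr,
    wilsonW₂_inr_inl, wilsonW₂_inl_inr, compB_apply_inr_inl, compB_apply_inl_inr]
  show (1 / 2 : ℝ) * ((P.cE₂ (j + 1) * 0 + P.cB (j + 1) * -(compVh2S _ _ _ Lc (j + 1) κ u κ' u' x z (Sum.inr m₁) (Sum.inl β)))
      + -1 * 1 * (P.cE₂ (j + 1) * 0 + P.cB (j + 1) * compVh2S _ _ _ Lc (j + 1) κ u κ' u' z x (Sum.inl β) (Sum.inr m₁))) = _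
  unfold compVh2S
  rw [packVH_symm _ _ κ' u' z x (Sum.inl β) (Sum.inr m₁)]
  ring

/-- [folklore] **the even half of `M2_N` vanishes on `(inr, inl)`** (`M2Of = wM2 • mixFF`, `mixFF_N = compMix = packFF …` is field–field). -/
theorem M2N_even_apply_inr_inl (κ : Fin (3 + 1)) (u : Fin (3 + 1) → ℤ) (ρ : Fin (3 + 1)) (w x z : Fin (3 + 1) → ℤ) (m₁ β : Fin (3 + 1)) :
    ((1 / 2 : ℝ) • (M2Of 3 (Lc ^ (j + 1)) (tabsComp (j + 1) (one_le_of_neZero Lc) R.hr (P.cM (j + 1))).mixFF 0 κ u ρ w + sgnK (trK (M2Of 3 (Lc ^ (j + 1)) (tabsComp (j + 1) (one_le_of_neZero Lc) R.hr (P.cM (j + 1))).mixFF 0 κ u ρ w)))) x z (Sum.inr m₁) (Sum.inl β) = 0 := by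
  have h1 : (tabsComp (j + 1) (one_le_of_neZero Lc) R.hr (P.cM (j + 1))).mixFF κ u ρ w x z (Sum.inr m₁) (Sum.inl β) = 0 := by
    rw [tabsComp_mixFF]; exact compMix_inr _ _ _ κ u ρ w x z m₁ _
  have h2 : (tabsComp (j + 1) (one_le_of_neZero Lc) R.hr (P.cM (j + 1))).mixFF κ u ρ w z x (Sum.inl β) (Sum.inr m₁) = 0 := by
    rw [tabsComp_mixFF]; simp only [compMix, CompositeMixedTable.compMixFF, CompositeHessianTable.packFF_inl_inr]
  simp only [M2Of, Pi.smul_apply, Pi.add_apply, smul_eq_mul, sgnK_apply, trK_apply, h1, h2, mul_zero, add_zero]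

/-- [folklore] the bi-vertex reads its table ENTRYWISE at a fixed fibre pair: tables agreeing on the `(a, b)` entries give bi-vertices agreeing there (`vertexOfK_apply` twice). -/
theorem vertex2OfK_apply_congr {d : ℕ} (K : MKer (d + 1) (Fib d)) (N : ℕ) {S₂ S₂' : Fin (d + 1) → (Fin (d + 1) → ℤ) → Fin (d + 1) → (Fin (d + 1) → ℤ) → MKer (d + 1) (Fib d)}
    {a b : Fib d} (h : ∀ (κ : Fin (d + 1)) (u : Fin (d + 1) → ℤ) (κ' : Fin (d + 1)) (u' x z : Fin (d + 1) → ℤ), S₂ κ u κ' u' x z a b = S₂' κ u κ' u' x z a b)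
    (μ : Fin (d + 1)) (y : Fin (d + 1) → ℤ) (ν : Fin (d + 1)) (y' x z : Fin (d + 1) → ℤ) :
    vertex2OfK K N S₂ μ y ν y' x z a b = vertex2OfK K N S₂' μ y ν y' x z a b := by
  simp only [SecondOrderResponse.vertex2OfK, vertexOfK_apply, h]

/-- [folklore] **`WN_evenHalf_apply_inr_inl` — ON THE MULTIPLIER–FIELD BLOCK THE EVEN N-FAMILY IS THE BORDER BI-VERTEX WORD ALONE**:
`WN♮ μ y ν y′ x z (inr m) (inl β) = −Pn.cB(j+1) · ½·(vertex2OfK (AN R j) (Lc^(j+1)) compVh2Sˢ μ y ν y′ + vertex2OfK (AN R j) (Lc^(j+1)) compVh2Sˢ ν y′ μ y) x z (inr m) (inl β)`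
— §2 at the entry; the mixed words vanish (`M2N_even_apply_inr_inl` + PART 13 `mixOfK_apply_eq_zero`), the response words cancel, the bi-vertex reads `−cB·compVh2Sˢ`
(`T2N_even_apply_inr_inl` + `vertex2OfK_apply_congr` + GAN24 `vertex2OfK_smul′`). -/
theorem WN_evenHalf_apply_inr_inl (μ : Fin (3 + 1)) (y : Fin (3 + 1) → ℤ) (ν : Fin (3 + 1)) (y' x z : Fin (3 + 1) → ℤ) (m₁ β : Fin (3 + 1)) :
    ((1 / 2 : ℝ) • (WN R P j μ y ν y' + sgnK (trK (WN R P j μ y ν y')))) x z (Sum.inr m₁) (Sum.inl β)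
      = -(P.cB (j + 1)) * ((1 / 2 : ℝ) * (vertex2OfK (AN R j) (Lc ^ (j + 1)) (compVh2S (fun _ : ℕ => symLinKerAt (toSite R.r) Lc) (fun _ : ℕ => symVhKerAt (toSite R.r) Lc) (fun _ : ℕ => symVh2KerSymAt (toSite R.r) Lc) Lc (j + 1)) μ y ν y' x z (Sum.inr m₁) (Sum.inl β)
          + vertex2OfK (AN R j) (Lc ^ (j + 1)) (compVh2S (fun _ : ℕ => symLinKerAt (toSite R.r) Lc) (fun _ : ℕ => symVhKerAt (toSite R.r) Lc) (fun _ : ℕ => symVh2KerSymAt (toSite R.r) Lc) Lc (j + 1)) ν y' μ y x z (Sum.inr m₁) (Sum.inl β))) := by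
  have hV : ∀ (μ : Fin (3 + 1)) (y : Fin (3 + 1) → ℤ) (ν : Fin (3 + 1)) (y' : Fin (3 + 1) → ℤ),
      vertex2OfK (compChart R.rc Lc (j + 1) (R.s (j + 1)) (Lc ^ (j + 1))) (Lc ^ (j + 1))
          (fun κ u κ' u' => (1 / 2 : ℝ) • (T2RecOf 3 (Lc ^ (j + 1)) (fun _ => compChart R.rc Lc (j + 1) (R.s (j + 1)) (Lc ^ (j + 1)))
        (SpureRecOf 3 (Lc ^ (j + 1)) (tabsComp (j + 1) (one_le_of_neZero Lc) R.hr (P.cM (j + 1))).V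
        (tabsComp (j + 1) (one_le_of_neZero Lc) R.hr (P.cM (j + 1))).H (fun _ => compChart R.rc Lc (j + 1) (R.s (j + 1)) (Lc ^ (j + 1)))
        (P.cE (j + 1)) (P.cVH (j + 1)) (P.cΛ (j + 1)))
        (tabsComp (j + 1) (one_le_of_neZero Lc) R.hr (P.cM (j + 1))).M (P.cE₂ (j + 1)) (P.cB (j + 1)) (P.T (j + 1))
        (tabsComp (j + 1) (one_le_of_neZero Lc) R.hr (P.cM (j + 1))).vh₂S (tabsComp (j + 1) (one_le_of_neZero Lc) R.hr (P.cM (j + 1))).mixFF 0 κ u κ' u'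
          + sgnK (trK (T2RecOf 3 (Lc ^ (j + 1)) (fun _ => compChart R.rc Lc (j + 1) (R.s (j + 1)) (Lc ^ (j + 1)))
        (SpureRecOf 3 (Lc ^ (j + 1)) (tabsComp (j + 1) (one_le_of_neZero Lc) R.hr (P.cM (j + 1))).V
        (tabsComp (j + 1) (one_le_of_neZero Lc) R.hr (P.cM (j + 1))).H (fun _ => compChart R.rc Lc (j + 1) (R.s (j + 1)) (Lc ^ (j + 1)))
        (P.cE (j + 1)) (P.cVH (j + 1)) (P.cΛ (j + 1)))
        (tabsComp (j + 1) (one_le_of_neZero Lc) R.hr (P.cM (j + 1))).M (P.cE₂ (j + 1)) (P.cB (j + 1)) (P.T (j + 1))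
        (tabsComp (j + 1) (one_le_of_neZero Lc) R.hr (P.cM (j + 1))).vh₂S (tabsComp (j + 1) (one_le_of_neZero Lc) R.hr (P.cM (j + 1))).mixFF 0 κ u κ' u')))) μ y ν y' x z (Sum.inr m₁) (Sum.inl β)
        = -(P.cB (j + 1)) * vertex2OfK (AN R j) (Lc ^ (j + 1)) (compVh2S (fun _ : ℕ => symLinKerAt (toSite R.r) Lc) (fun _ : ℕ => symVhKerAt (toSite R.r) Lc) (fun _ : ℕ => symVh2KerSymAt (toSite R.r) Lc) Lc (j + 1)) μ y ν y' x z (Sum.inr m₁) (Sum.inl β) := fun μ y ν y' => by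
    rw [AN_eq, vertex2OfK_apply_congr _ _ (S₂' := fun κ u κ' u' => (-(P.cB (j + 1))) • (compVh2S (fun _ : ℕ => symLinKerAt (toSite R.r) Lc) (fun _ : ℕ => symVhKerAt (toSite R.r) Lc) (fun _ : ℕ => symVh2KerSymAt (toSite R.r) Lc) Lc (j + 1)) κ u κ' u')
      (fun κ u κ' u' x z => by rw [T2N_even_apply_inr_inl R P j]; simp only [Pi.smul_apply, smul_eq_mul]) μ y ν y' x z,
      GAN24.SecondOrderReadersParity.vertex2OfK_smul']
    simp only [Pi.smul_apply, smul_eq_mul]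
  have hM : ∀ (μ : Fin (3 + 1)) (y : Fin (3 + 1) → ℤ) (ν : Fin (3 + 1)) (y' : Fin (3 + 1) → ℤ),
      mixOfK (compChart R.rc Lc (j + 1) (R.s (j + 1)) (Lc ^ (j + 1))) (Lc ^ (j + 1))
          (fun κ u ρ w => (1 / 2 : ℝ) • (M2Of 3 (Lc ^ (j + 1)) (tabsComp (j + 1) (one_le_of_neZero Lc) R.hr (P.cM (j + 1))).mixFF 0 κ u ρ w + sgnK (trK (M2Of 3 (Lc ^ (j + 1)) (tabsComp (j + 1) (one_le_of_neZero Lc) R.hr (P.cM (j + 1))).mixFF 0 κ u ρ w)))) μ y ν y' x z (Sum.inr m₁) (Sum.inl β) = 0 := fun μ y ν y' =>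
    mixOfK_apply_eq_zero (fun κ u ρ w x z => M2N_even_apply_inr_inl R P j κ u ρ w x z m₁ β) μ y ν y' x z
  rw [WN_evenHalf_eq R P j μ y ν y']
  simp only [SecondOrderResponse.W2SymOfK, W2OfK_apply, Pi.smul_apply, Pi.add_apply, Pi.sub_apply, smul_eq_mul, hV, hM]
  ring

end Block

end Summit.QuantumFields.BalabanUV.Beta.NVertexEvenBorder

end
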